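import Literature.MathematicalPhysics.QuantumFieldTheory.Balaban1983to89.B6Prop22KLevelTorusCensusL0
import Literature.MathematicalPhysics.QuantumFieldTheory.Balaban1983to89.B6Cover236MultiLevelBlocks
import Literature.MathematicalPhysics.QuantumFieldTheory.Balaban1983to89.B4Sect5Torus

/-!
# `Balaban1983to89.B9CubeSequence408` — [B9] Sect. C p. 408–409: THE NESTED CUBE FAMILY `{Ω_n(□)}` OF A COVER CUBE `□ ∈ 𝒟_j`
# (whose [4]-operators are print's cube-local letters `G′_□(U)`, `C_□(U)`, `G_□(U)`), as a LEVEL-0-ADMITTING `k`-LEVEL TORUS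
# FAMILY of the `…L0` lineage on the SAME torus as the global family — sub-row G-B9-LETTERS, module M5.1a, file 1 (the datum)

FRAMING (verbatim cell line):
statement-level skeleton of published theorems with citation tags; proofs where landed; nothing here is a claim about the Yang–Mills mass gap

Sources under audit (cell lit-balaban): T. Bałaban, *Propagators for lattice gauge theories in a background field*, Commun.
Math. Phys. **99** (1985) 389–434 [`Balaban1985BackgroundPropagators`, "B9"], p. 408 [PDF 20] l. −14 ff. and p. 409 [PDF 21]
l. 1–5 (held text layer `paper:balaban1985-cmp99-background-propagators` p0020/p0021 read this generation); T. Bałaban, *Propagators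
and renormalization transformations for lattice gauge theories. II*, Commun. Math. Phys. **96** (1984) 223–250
[`Balaban1984PropagatorsII`, "[4]"], (2.1)–(2.4) p. 224, (2.14) p. 225, p. 229 (held text p0002/p0003).  Unit `lit-balaban-r05`
(r05 gen 77; sub-row G-B9-LETTERS hand for M5.1a, lead g29 ALLOCATIONS #2 2026-08-28; map of record `lit-balaban-r06/B9-LETTERS-MAP.md`
v1 §4 M5.1a); B9 fold owner r06, B6 fold owner r03, referee ref-4.

## WHAT IS PRINTED (verbatim up to notation)

[B9] p. 408: «Let us take a cube □ ∈ 𝒟_j and let us define a sequence {Ω_n(□)}_{n=0,…,j+1} of domains in the following way. The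
cube □³ is either contained in B^j(Λ_j), or intersects also the domain B^{j+1}(Λ_{j+1}). Let us assume the second case, then we
define Ω_{j+1}(□) = □³ ∩ B^{j+1}(Λ_{j+1}). We take Ω_j(□) = □⁴, Ω_{j−1}(□) is a cube with a center at the center of □ and
dist(Ω_{j−1}(□)ᶜ, Ω_j(□)) = 2R₀M₀L^{j−1}η, and generally Ω_n(□) is a cube with a center at the center of □ and dist(Ω_n(□)ᶜ,
Ω_{n+1}(□)) = 2R₀M₀Lⁿη … This sequence satisfies the conditions (2.1), (2.2) with j instead of k … For n ≥ 0 we have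
dist(Ω₀(□)ᶜ, □⁴) < 2R₀M₀L^jη, hence Ω₀(□) ⊂ □⁵.»  p. 409: «the sequence {Ω_n(□)} satisfies the assumptions of Corollary 3.6.
The operators constructed for this sequence, which we denote by G′_□(U), C_□(U) = (Q′(U)G′_□²(U)Q′*(U))⁻¹, G_□(U), satisfy all
the inequalities of Theorems 3.1–3.3 correspondingly. This is the basis of all estimates for the expansions we will construct.»
p. 408 also: «We need two different scales … M = KR₀M₀».  [4] p. 225 (2.14): «Σ_{j=0}^{k} … we assume that (Q′₀λ)(x) = λ(x),
x ∈ Λ₀»; [4] p. 229: «Boundary conditions of this type can be interpreted as obtained by building an effective mass on the domain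
Ω₁∖Ω_k, starting from O(1) on Ω_k up to +∞ outside Ω₁.»

## WHAT THIS FILE CERTIFIES (kernel-checked; lattice units of the lineage, `η = 1`, `L = ℓ + 1`, big blocks `bigSide ℓ M_h j = M_h·L^{j+1}`)

For a `k`-level torus family `D : B6MultiLevelTorusOperator.TDomains d ℓ M_h k P R` (the global sequence `{Ω_j}`, `Ω₁ = T_η`) and a
cover cube `q = (j, β) ∈ B6Cover236MultiLevelBlocks.cubes D.toDomains` (p21's cover `𝒟`: the active big `j`-block `β`, standing
for the concentric cube □ of side `2ML^j`):
* `cubeFam D q …` — **THE CUBE FAMILY OF □ AS A `B6MultiLevelTorusOperatorL0.TDomains d ℓ M_h k P R` ON THE SAME TORUS** (so its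
  [4]-operators — `gmlT`, the (2.87) inverse, the V1 vector inverse — are the `…L0` lineage's, and every `…L0` theorem, in particular
  p33's census `B6Prop22KLevelTorusCensusL0.prop22_supEntries_kLevelTorus`, applies to it BY NAME through `toKTIdx`): its level
  function is `min (D.lev x) (prof q x)`, where the PROFILE `prof q` of □ is print's concentric profile — `j + 1` on the hull `H(□)`
  of the three big `(j+1)`-blocks around `β` (⊇ □³; only when `j + 1 ≤ k`), `J` on the concentric cube `C_J(□)` of half-width
  `w_J = (S_j − 1)/2 + (R + 2L)S_j + (R + 2)(S_J + … + S_{j−1})` (`S_n = bigSide ℓ M_h n`) for `1 ≤ J ≤ j`, and `0` outside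
  `C₁(□)` (print's «Λ₀», here carrying (2.14)'s mass `a₀` on the whole exterior — [4] p. 229's device; see HONEST SCOPE);
  the structure fields ARE (2.1) (`bigBlocks`, every level `≥ 1`) and (2.2) in the torus distance (`sepT`) — print's «This sequence
  satisfies the conditions (2.1), (2.2)»;
* `lev_cubeFam_eq_of_InH` — **ON THE HULL `H(□) ⊇ □³` THE CUBE FAMILY HAS THE GLOBAL LEVELS** (`min = D.lev`, because no site of
  level `≥ j + 2` lies within `2L·S_j` of □ by (2.2)): the rows of the cube operator `Δ′_{a,□}` and of the global `Δ′_a` agree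
  there — the identity behind (3.88) `Δ′_a h_□G′_□ = h_□ − K(h_□)G′_□` on `supp h_□` (M5.4's `hloc`);
* the bookkeeping the consumers need: `le_prof_iff` / `succ_le_prof_iff` (membership dictionary), `InC_iff_of_blk_eq`,
  `InH_iff_of_blk_eq` (block invariance = (2.1) for the profile), `lev_cubeFam_le` (`≤ D.lev`), `toKTIdx` (+ `toKTIdx_D`,
  `toKTIdx_hyp`) = the cube family as an index of p33's census of ALL level-0 torus families.

## HONEST SCOPE (deviations from the letter of p. 408, each harmless for Thms 3.1–3.3 and declared)

* ONE scale: print separates the cover scale `M = KR₀M₀` from the scale `R₀M₀` at which (2.1)–(2.2) are checked; here the collars are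
  `(R + 2)·S_J` and `(R + 2L)·S_j` in the family's own `(R, M)` (so (2.2) holds with the member's `R`), and the lower cubes are
  aligned to `S_J`-blocks through the common centre of `β` (odd sides: `L` odd, `M_h` odd — the programme's `M_h = L^a`).
  Consequence: `Ω₁(□)` has half-width `< (R + 2L + (R+2)/(L−1))·S_j` instead of print's `Ω₀(□) ⊂ □⁵`; the constants of Thms
  3.1–3.3 (functions of `d, L` — census) are untouched.
* EXTERIOR: print puts Dirichlet rows outside `Ω₀(□)` beyond a level-`0` collar with (2.14)'s mass; here level `0` (= `T ∖ C₁(□)`,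
  single-site blocks, weight `a₀`) extends over the whole exterior — [4] p. 229 «effective mass … up to +∞ outside Ω₁» kept at its
  O(1) value, exactly the `…L0` lineage's reading («finite lattice-scale mass at level 0 … no Dirichlet rows»).  `G′_□` is then a
  full-torus operator exponentially localised at □; no support statement «⊂ □⁵» is claimed.
* LEVELS BELOW `j` INSIDE THE CUBES follow the GLOBAL family (`min`), where print writes `Ω_j(□) = □⁴` flat; under print's case
  hypothesis («□³ ⊂ B^j(Λ_j) ∪ B^{j+1}(Λ_{j+1})») the two agree on □³, and `min` is what makes `lev_cubeFam_eq_of_InH` hold in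
  EVERY case of the lineage's cover (p21's `Down` cubes included).
* Nothing is inferred from the manuscript: every step is kernel-checked.  Value = the datum of M5.1a (staged root of M5.1b with
  file 2's statements); NOT summit progress; the YM mass gap is not proved by any of this (Track A conditional rung).
-/

namespace Literature.MathematicalPhysics.QuantumFieldTheory.Balaban1983to89.B9CubeSequence408

open Finset
open Literature.MathematicalPhysics.QuantumFieldTheory.Balaban1983to89.B4Reflection242 (boxDom mem_boxDom blk)
open Literature.MathematicalPhysics.QuantumFieldTheory.Balaban1983to89.B4TorusKernel.MultiPeriod (torusSupNorm circAbs centre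
  abs_add_mul_centre circAbs_le_abs circAbs_add_mul circAbs_nonneg two_mul_circAbs_le)
open Literature.MathematicalPhysics.QuantumFieldTheory.Balaban1983to89.B6MultiLevelBoxOperator (N0 bigSide bigSide_succ one_le_bigSide)
open Literature.MathematicalPhysics.QuantumFieldTheory.Balaban1983to89.B6MultiLevelTorusOperator (one_le_N0 N0_eq_bigSide_mul)
open Literature.MathematicalPhysics.QuantumFieldTheory.Balaban1983to89.B6Cover236MultiLevelBlocks (cubes wit lev_wit blk_wit)
open Literature.MathematicalPhysics.QuantumFieldTheory.Balaban1983to89.B6Prop22KLevelTorusCensusL0 (KTIdx)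
open Literature.MathematicalPhysics.QuantumFieldTheory.Balaban1983to89.B4Sect5Torus (circAbs_add_le circAbs_neg_le)
open Literature.MathematicalPhysics.QuantumFieldTheory.Balaban1983to89.B6Prop22KLevelTorusCensus.KTIdx (circAbs_le_torusSupNorm)

variable {d : ℕ}

/-! ## §1 Torus arithmetic: the two-window gap and the block invariance of aligned windows (triangle inequality = `B4Sect5Torus`) -/

section Arith

/-- `dist(a − b, Nℤ) = dist(b − a, Nℤ)`. [cite: Balaban1984PropagatorsII, (2.2) p.224 (torus distance), dictionary] -/
theorem circAbs_sub_comm {N : ℕ} (hN : 1 ≤ N) (a b : ℤ) : circAbs N (a - b) = circAbs N (b - a) := by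
  apply le_antisymm
  · have := circAbs_neg_le hN (b - a); rwa [neg_sub] at this
  · have := circAbs_neg_le hN (a - b); rwa [neg_sub] at this

/-- the two-window gap: `dist(x − m) > w`, `dist(x′ − m) ≤ w′` ⟹ `dist(x − x′) > w − w′`. [cite: Balaban1985BackgroundPropagators, p.408 («dist(Ω_n(□)ᶜ, Ω_{n+1}(□)) = 2R₀M₀Lⁿη»), mechanism] -/
theorem gap_of_windows {N : ℕ} (hN : 1 ≤ N) {m w w' x x' : ℤ} (hx : w < circAbs N (x - m))
    (hx' : circAbs N (x' - m) ≤ w') : w - w' < circAbs N (x - x') := by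
  have h := circAbs_add_le hN (x - x') (x' - m)
  rw [show x - x' + (x' - m) = x - m by ring] at h
  linarith

/-- **BLOCK INVARIANCE OF AN ALIGNED WINDOW**: if `S ∣ N`, the window `{y : dist(y − m, Nℤ) ≤ w}` has its ends on the `S`-grid
(`S ∣ m − w`, `S ∣ m + w + 1`), and `x, x′` lie in one `S`-block (`⌊x/S⌋ = ⌊x′/S⌋`), then `x` is in the window iff `x′` is —
(2.1) «a sum of big blocks» for a concentric cube of the torus. [cite: Balaban1984PropagatorsII, (2.1) p.224, mechanism] -/
theorem window_of_blk_eq {N S : ℕ} (hN : 1 ≤ N) (hS : 0 < (S : ℤ)) (hSN : (S : ℤ) ∣ (N : ℤ)) {m w : ℤ}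
    (hlo : (S : ℤ) ∣ m - w) (hhi : (S : ℤ) ∣ m + w + 1) {x x' : ℤ} (hb : x / (S : ℤ) = x' / (S : ℤ))
    (h : circAbs N (x - m) ≤ w) : circAbs N (x' - m) ≤ w := by
  obtain ⟨p, hp⟩ := hlo
  obtain ⟨p', hp'⟩ := hhi
  obtain ⟨q, hq⟩ := hSN
  set c := centre N (x - m) with hc
  have ht : |x - m + N * c| = circAbs N (x - m) := abs_add_mul_centre hN _
  obtain ⟨h1, h2⟩ := abs_le.1 (ht.symm ▸ h)
  have hNc : (N : ℤ) * c = (q * c) * S := by rw [hq]; ring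
  -- the representative `x + Nc` lies in `[m − w, m + w] = [Sp, Sp′ − 1]`
  have e1 : (x + (q * c) * S) / S = x / S + q * c := Int.add_mul_ediv_right _ _ hS.ne'
  have hp_le : p ≤ x / S + q * c := by
    rw [← e1]; exact (Int.le_ediv_iff_mul_le hS).2 (by nlinarith)
  have hp'_gt : x / S + q * c < p' := by
    rw [← e1]; exact (Int.ediv_lt_iff_lt_mul hS).2 (by nlinarith)
  -- hence so does `x′ + Nc`
  have e2 : (x' + (q * c) * S) / S = x' / S + q * c := Int.add_mul_ediv_right _ _ hS.ne'
  have h3 : p * S ≤ x' + (q * c) * S := (Int.le_ediv_iff_mul_le hS).1 (by rw [e2, ← hb]; exact hp_le)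
  have h4 : x' + (q * c) * S < p' * S := (Int.ediv_lt_iff_lt_mul hS).1 (by rw [e2, ← hb]; exact hp'_gt)
  have h5 : |x' - m + N * c| ≤ w := abs_le.2 ⟨by nlinarith, by nlinarith⟩
  calc circAbs N (x' - m) = circAbs N (x' - m + N * c) := (circAbs_add_mul N _ c).symm
    _ ≤ |x' - m + N * c| := circAbs_le_abs hN _
    _ ≤ w := h5

/-- the torus sup-distance is at most any common bound of the coordinates' circular distances. [cite: Balaban1984PropagatorsII, (2.2) p.224 (torus distance), dictionary] -/
theorem torusSupNorm_le_of_forall (N : Fin (d + 1) → ℕ) (v : Fin (d + 1) → ℤ) {C : ℝ}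
    (h : ∀ μ, ((circAbs (N μ) (v μ) : ℤ) : ℝ) ≤ C) : torusSupNorm N v ≤ C :=
  Finset.sup'_le _ _ (fun i _ => h i)

end Arith

/-! ## §2 The scales: odd sides, half-sides, collars and half-widths -/

section Scales

variable (ℓ Mh : ℕ)

/-- the side `S_J = M_h·L^{J+1}` of a big `J`-block, as an integer. [cite: Balaban1984PropagatorsII, (2.1) p.224 («M is a size of big blocks»), dictionary] -/
def sI (J : ℕ) : ℤ := (bigSide ℓ Mh J : ℤ)

/-- the half-side `(S_J − 1)/2` (exact for odd sides). [cite: Balaban1985BackgroundPropagators, p.408 («a cube with a center at the center of □»), dictionary] -/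
def hf (J : ℕ) : ℤ := (sI ℓ Mh J - 1) / 2

/-- `(L − 1)/2` (exact: `L = ℓ + 1` odd). [cite: Balaban1985BackgroundPropagators, p.408, dictionary] -/
def mL : ℤ := (ℓ : ℤ) / 2

/-- **THE COLLARS**: `a_J = (R + 2L)·S_j + (R + 2)·(S_J + … + S_{j−1})` — one `(R+2)S_n`-collar per level `n = J, …, j − 1` below
the top collar `(R + 2L)S_j` (print: «dist(Ω_n(□)ᶜ, Ω_{n+1}(□)) = 2R₀M₀Lⁿη», here in the member's own `(R, M)`).
[cite: Balaban1985BackgroundPropagators, p.408] -/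
def collar (R j J : ℕ) : ℤ :=
  ((R : ℤ) + 2 * ((ℓ : ℤ) + 1)) * sI ℓ Mh j + ((R : ℤ) + 2) * ∑ i ∈ Finset.Ico J j, sI ℓ Mh i

/-- the half-width `w_J = (S_j − 1)/2 + a_J` of the level-`J` cube `C_J(□)` about the centre of `β`. [cite: Balaban1985BackgroundPropagators, p.408] -/
def wid (R j J : ℕ) : ℤ := hf ℓ Mh j + collar ℓ Mh R j J

/-- the half-width `(3·L·S_j − 1)/2` of the hull `H(□)` = three big `(j+1)`-blocks, written without division:
`3·(L·hf_j + m_L) + 1`. [cite: Balaban1985BackgroundPropagators, p.408 («Ω_{j+1}(□) = □³ ∩ B^{j+1}(Λ_{j+1})»), dictionary] -/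
def widH (j : ℕ) : ℤ := 3 * (((ℓ : ℤ) + 1) * hf ℓ Mh j + mL ℓ) + 1

/-- the radius `widH + m_L·S_j` of the hull about the centre of `β` (the hull is centred at the parent block, at most `m_L·S_j` away). [cite: Balaban1985BackgroundPropagators, p.408, dictionary] -/
def radH (j : ℕ) : ℤ := widH ℓ Mh j + mL ℓ * sI ℓ Mh j

variable {ℓ Mh}

/-- `S_J > 0` (`M_h ≥ 1`). [cite: Balaban1984PropagatorsII, (2.1) p.224, dictionary] -/
theorem sI_pos (hMh : 1 ≤ Mh) (J : ℕ) : 0 < sI ℓ Mh J := by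
  unfold sI; exact_mod_cast one_le_bigSide hMh J

/-- `S_J` is odd when `L` and `M_h` are. [cite: Balaban1984PropagatorsII, (2.1) p.224, dictionary] -/
theorem sI_odd (hL : Odd (ℓ + 1)) (hM : Odd Mh) (J : ℕ) : Odd (sI ℓ Mh J) := by
  unfold sI bigSide
  have h : Odd (Mh * (ℓ + 1) ^ (J + 1)) := hM.mul (hL.pow)
  exact_mod_cast h

/-- `2·hf_J + 1 = S_J`. [cite: Balaban1985BackgroundPropagators, p.408, dictionary] -/
theorem two_mul_hf_add_one (hL : Odd (ℓ + 1)) (hM : Odd Mh) (J : ℕ) : 2 * hf ℓ Mh J + 1 = sI ℓ Mh J := by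
  obtain ⟨m, hm⟩ := sI_odd hL hM J
  unfold hf; omega

/-- `2·m_L = ℓ` (`L = ℓ + 1` odd). [cite: Balaban1985BackgroundPropagators, p.408, dictionary] -/
theorem two_mul_mL (hL : Odd (ℓ + 1)) : 2 * mL ℓ = (ℓ : ℤ) := by
  obtain ⟨m, hm⟩ := hL
  unfold mL; omega

/-- `0 ≤ m_L`. [cite: Balaban1985BackgroundPropagators, p.408, dictionary] -/
theorem mL_nonneg : 0 ≤ mL ℓ := by unfold mL; positivity

/-- `S_{J+1} = L·S_J`. [cite: Balaban1984PropagatorsII, (2.1) p.224, dictionary] -/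
theorem sI_succ (J : ℕ) : sI ℓ Mh (J + 1) = ((ℓ : ℤ) + 1) * sI ℓ Mh J := by
  unfold sI; rw [bigSide_succ]; push_cast; ring

/-- `S_J ∣ S_{J′}` for `J ≤ J′` (the blocks nest). [cite: Balaban1984PropagatorsII, (2.1) p.224, dictionary] -/
theorem sI_dvd_sI {J J' : ℕ} (h : J ≤ J') : sI ℓ Mh J ∣ sI ℓ Mh J' := by
  obtain ⟨t, rfl⟩ := Nat.exists_eq_add_of_le h
  refine ⟨((ℓ : ℤ) + 1) ^ t, ?_⟩
  unfold sI bigSide; push_cast; ring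

/-- `S_J ∣ N₀_μ` for `J ≤ k` (the torus side `N₀_μ = S_k·P_μ`). [cite: Balaban1984PropagatorsII, (2.1) p.224, dictionary] -/
theorem sI_dvd_N0 {k : ℕ} (P : Fin (d + 1) → ℕ) {J : ℕ} (h : J ≤ k) (μ : Fin (d + 1)) :
    sI ℓ Mh J ∣ (N0 ℓ Mh k P μ : ℤ) := by
  rw [N0_eq_bigSide_mul]; push_cast
  exact Dvd.dvd.mul_right (sI_dvd_sI h) _

/-- `0 ≤ collar`. [cite: Balaban1985BackgroundPropagators, p.408, bookkeeping] -/
theorem collar_nonneg (hMh : 1 ≤ Mh) (R j J : ℕ) : 0 ≤ collar ℓ Mh R j J := by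
  unfold collar
  have h1 : 0 ≤ sI ℓ Mh j := (sI_pos hMh j).le
  have h2 : 0 ≤ ∑ i ∈ Finset.Ico J j, sI ℓ Mh i := Finset.sum_nonneg fun i _ => (sI_pos hMh i).le
  positivity

/-- the top collar: `a_j = (R + 2L)·S_j`. [cite: Balaban1985BackgroundPropagators, p.408 («Ω_j(□) = □⁴»), dictionary] -/
theorem collar_top (R j : ℕ) : collar ℓ Mh R j j = ((R : ℤ) + 2 * ((ℓ : ℤ) + 1)) * sI ℓ Mh j := by
  unfold collar; rw [Finset.Ico_self, Finset.sum_empty, mul_zero, add_zero]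

/-- the collar recursion: `a_J = a_{J+1} + (R + 2)·S_J` for `J < j`. [cite: Balaban1985BackgroundPropagators, p.408 («dist(Ω_n(□)ᶜ, Ω_{n+1}(□)) = 2R₀M₀Lⁿη»)] -/
theorem collar_succ {R j J : ℕ} (h : J < j) : collar ℓ Mh R j J = collar ℓ Mh R j (J + 1) + ((R : ℤ) + 2) * sI ℓ Mh J := by
  unfold collar; rw [Finset.sum_eq_sum_Ico_succ_bot h]; ring

/-- the collars decrease with the level: `a_{J′} ≤ a_J` for `J ≤ J′`. [cite: Balaban1985BackgroundPropagators, p.408, bookkeeping] -/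
theorem collar_anti (hMh : 1 ≤ Mh) (R j : ℕ) {J J' : ℕ} (h : J ≤ J') : collar ℓ Mh R j J' ≤ collar ℓ Mh R j J := by
  unfold collar
  have hs : ∑ i ∈ Finset.Ico J' j, sI ℓ Mh i ≤ ∑ i ∈ Finset.Ico J j, sI ℓ Mh i :=
    Finset.sum_le_sum_of_subset_of_nonneg (Finset.Ico_subset_Ico_left h) (fun i _ _ => (sI_pos hMh i).le)
  have hR : (0 : ℤ) ≤ (R : ℤ) + 2 := by positivity
  nlinarith

/-- `w_{J′} ≤ w_J` for `J ≤ J′` (the cubes are nested). [cite: Balaban1985BackgroundPropagators, p.408, bookkeeping] -/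
theorem wid_anti (hMh : 1 ≤ Mh) (R j : ℕ) {J J' : ℕ} (h : J ≤ J') : wid ℓ Mh R j J' ≤ wid ℓ Mh R j J := by
  unfold wid; linarith [collar_anti (ℓ := ℓ) hMh R j h]

/-- `S_J ∣ a_J` for `J ≤ j` (the collars are unions of `J`-big blocks). [cite: Balaban1984PropagatorsII, (2.1) p.224, bookkeeping] -/
theorem sI_dvd_collar (R : ℕ) {j J : ℕ} (h : J ≤ j) : sI ℓ Mh J ∣ collar ℓ Mh R j J := by
  unfold collar
  refine dvd_add (Dvd.dvd.mul_left (sI_dvd_sI h) _) (Dvd.dvd.mul_left (Finset.dvd_sum fun i hi => ?_) _)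
  exact sI_dvd_sI (Finset.mem_Ico.1 hi).1

/-- **THE ARITHMETIC OF THE TOP GAP**: `radH + (R + 1)·S_j = w_j`, i.e. the hull sits `(R+1)S_j` inside `C_j(□)`.
[cite: Balaban1985BackgroundPropagators, p.408 (Ω_{j+1}(□) ⊂ □³, Ω_j(□) = □⁴), bookkeeping] -/
theorem radH_add_eq_wid (hL : Odd (ℓ + 1)) (hM : Odd Mh) (R j : ℕ) :
    radH ℓ Mh j + ((R : ℤ) + 1) * sI ℓ Mh j = wid ℓ Mh R j j := by
  have h1 := two_mul_hf_add_one hL hM j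
  have h2 := two_mul_mL (ℓ := ℓ) hL
  unfold radH widH wid
  rw [collar_top]
  linear_combination (3 * mL ℓ + 1) * h1 - (3 * hf ℓ Mh j - 2 * sI ℓ Mh j) * h2

/-- `hf_j + radH = 2·L·S_j − 1` (the diameter bound of the hull about a site of `β`). [cite: Balaban1985BackgroundPropagators, p.408, bookkeeping] -/
theorem hf_add_radH (hL : Odd (ℓ + 1)) (hM : Odd Mh) (j : ℕ) :
    hf ℓ Mh j + radH ℓ Mh j = 2 * ((ℓ : ℤ) + 1) * sI ℓ Mh j - 1 := by
  have h1 := two_mul_hf_add_one hL hM j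
  have h2 := two_mul_mL (ℓ := ℓ) hL
  unfold radH widH
  linear_combination (3 * mL ℓ + 2) * h1 - (3 * hf ℓ Mh j - 2 * sI ℓ Mh j) * h2

end Scales

/-! ## §3 The profile of a cover cube: the concentric cubes `C_J(□)`, the hull `H(□)`, the profile level -/

section Profile

variable {ℓ Mh k R : ℕ} {P : Fin (d + 1) → ℕ} {D : B6MultiLevelTorusOperator.TDomains d ℓ Mh k P R}

/-- the centre of the big block `β` of the cube: `β_μ·S_j + (S_j − 1)/2` (a lattice point: odd sides). [cite: Balaban1985BackgroundPropagators, p.408 («with centers at points of this lattice … a center at the center of □»)] -/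
def ctrC (q : ↥(cubes D.toDomains)) : Fin (d + 1) → ℤ := fun μ => q.1.2 μ * sI ℓ Mh q.1.1 + hf ℓ Mh q.1.1

/-- the centre of the big `(j+1)`-block containing `β`: `⌊β_μ/L⌋·(L·S_j) + (L·S_j − 1)/2`, written without division of odd numbers.
[cite: Balaban1985BackgroundPropagators, p.408 («Ω_{j+1}(□) = □³ ∩ B^{j+1}(Λ_{j+1})»), dictionary] -/
def ctrH (q : ↥(cubes D.toDomains)) : Fin (d + 1) → ℤ := fun μ =>
  (q.1.2 μ / ((ℓ : ℤ) + 1)) * (((ℓ : ℤ) + 1) * sI ℓ Mh q.1.1) + (((ℓ : ℤ) + 1) * hf ℓ Mh q.1.1 + mL ℓ)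

/-- **`x ∈ C_J(□)`**: every coordinate of `x` is within torus distance `w_J` of the centre of `β` — the concentric cube of level `J`
(«Ω_n(□) is a cube with a center at the center of □»). [cite: Balaban1985BackgroundPropagators, p.408] -/
def InC (q : ↥(cubes D.toDomains)) (J : ℕ) (x : Fin (d + 1) → ℤ) : Prop :=
  ∀ μ, circAbs (N0 ℓ Mh k P μ) (x μ - ctrC q μ) ≤ wid ℓ Mh R q.1.1 J

/-- **`x ∈ H(□)`**: `j + 1 ≤ k` and every coordinate of `x` is within `(3LS_j − 1)/2` of the centre of the parent block of `β` — the
union of the `3^{d+1}` big `(j+1)`-blocks around `β` (⊇ □³; its intersection with `Ω_{j+1}` is the cube family's top level,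
print's «Ω_{j+1}(□) = □³ ∩ B^{j+1}(Λ_{j+1})» up to the big-block hull). [cite: Balaban1985BackgroundPropagators, p.408] -/
def InH (q : ↥(cubes D.toDomains)) (x : Fin (d + 1) → ℤ) : Prop :=
  q.1.1 + 1 ≤ k ∧ ∀ μ, circAbs (N0 ℓ Mh k P μ) (x μ - ctrH q μ) ≤ widH ℓ Mh q.1.1

open Classical in
/-- **THE PROFILE LEVEL OF □**: `j + 1` on the hull, otherwise the largest `J ≤ j` with `x ∈ C_J(□)` (`0` outside `C₁(□)` — print's
exterior «Λ₀»). [cite: Balaban1985BackgroundPropagators, p.408 (the sequence {Ω_n(□)}_{n=0,…,j+1})] -/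
noncomputable def prof (q : ↥(cubes D.toDomains)) (x : Fin (d + 1) → ℤ) : ℕ :=
  if InH q x then q.1.1 + 1 else Nat.findGreatest (fun J => InC q J x) q.1.1

/-- the cubes are nested: `C_{J′}(□) ⊂ C_J(□)` for `J ≤ J′`. [cite: Balaban1985BackgroundPropagators, p.408, bookkeeping] -/
theorem InC_of_le (hMh : 1 ≤ Mh) {q : ↥(cubes D.toDomains)} {J J' : ℕ} (h : J ≤ J') {x : Fin (d + 1) → ℤ}
    (hx : InC q J' x) : InC q J x := fun μ => (hx μ).trans (wid_anti hMh R q.1.1 h)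

/-- the level of a cover cube is at most `k`. [cite: Balaban1984PropagatorsII, (2.1) p.224, bookkeeping] -/
theorem cube_level_le (q : ↥(cubes D.toDomains)) : q.1.1 ≤ k := by
  rw [← lev_wit D.toDomains q]; exact D.lev_le _

/-- the level of a cover cube is at least `1` (`Ω₁ = T_η`). [cite: Balaban1984PropagatorsII, (2.1) p.224, bookkeeping] -/
theorem one_le_cube_level (q : ↥(cubes D.toDomains)) : 1 ≤ q.1.1 := by
  rw [← lev_wit D.toDomains q]; exact D.one_le_lev _

/-- the two centres differ by at most `m_L·S_j` in every coordinate: `ctrC − ctrH = (β mod L − m_L)·S_j`. [cite: Balaban1985BackgroundPropagators, p.408, bookkeeping] -/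
theorem abs_ctrC_sub_ctrH_le (hL : Odd (ℓ + 1)) (hM : Odd Mh) (hMh : 1 ≤ Mh) (q : ↥(cubes D.toDomains))
    (μ : Fin (d + 1)) : |ctrC q μ - ctrH q μ| ≤ mL ℓ * sI ℓ Mh q.1.1 := by
  have hL0 : (0 : ℤ) < (ℓ : ℤ) + 1 := by positivity
  have hS := sI_pos (ℓ := ℓ) hMh q.1.1
  have h1 := two_mul_hf_add_one hL hM q.1.1
  have h2 := two_mul_mL (ℓ := ℓ) hL
  have hr : q.1.2 μ - (q.1.2 μ / ((ℓ : ℤ) + 1)) * ((ℓ : ℤ) + 1) = q.1.2 μ % ((ℓ : ℤ) + 1) := by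
    rw [Int.emod_def]; ring
  have hr0 : 0 ≤ q.1.2 μ - (q.1.2 μ / ((ℓ : ℤ) + 1)) * ((ℓ : ℤ) + 1) := by
    rw [hr]; exact Int.emod_nonneg _ hL0.ne'
  have hr1 : q.1.2 μ - (q.1.2 μ / ((ℓ : ℤ) + 1)) * ((ℓ : ℤ) + 1) ≤ (ℓ : ℤ) := by
    rw [hr]; have := Int.emod_lt_of_pos (q.1.2 μ) hL0; omega
  have e : ctrC q μ - ctrH q μ = (q.1.2 μ - (q.1.2 μ / ((ℓ : ℤ) + 1)) * ((ℓ : ℤ) + 1) - mL ℓ) * sI ℓ Mh q.1.1 := by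
    unfold ctrC ctrH
    linear_combination hf ℓ Mh q.1.1 * h2 - mL ℓ * h1
  rw [e, abs_mul, abs_of_pos hS]
  exact mul_le_mul_of_nonneg_right (abs_le.2 ⟨by linarith, by linarith⟩) hS.le

/-- **THE HULL LIES WITHIN `radH` OF THE CENTRE OF `β`**. [cite: Balaban1985BackgroundPropagators, p.408 (□³ ⊂ □⁴), bookkeeping] -/
theorem circAbs_ctrC_le_of_InH (hL : Odd (ℓ + 1)) (hM : Odd Mh) (hMh : 1 ≤ Mh) (hP : ∀ μ, 1 ≤ P μ)
    {q : ↥(cubes D.toDomains)} {x : Fin (d + 1) → ℤ} (hx : InH q x) (μ : Fin (d + 1)) :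
    circAbs (N0 ℓ Mh k P μ) (x μ - ctrC q μ) ≤ radH ℓ Mh q.1.1 := by
  have hN : 1 ≤ N0 ℓ Mh k P μ := one_le_N0 hMh hP μ
  have h1 := circAbs_add_le hN (x μ - ctrH q μ) (ctrH q μ - ctrC q μ)
  rw [show x μ - ctrH q μ + (ctrH q μ - ctrC q μ) = x μ - ctrC q μ by ring] at h1
  have h2 : circAbs (N0 ℓ Mh k P μ) (ctrH q μ - ctrC q μ) ≤ mL ℓ * sI ℓ Mh q.1.1 :=
    (circAbs_le_abs hN _).trans (by rw [abs_sub_comm]; exact abs_ctrC_sub_ctrH_le hL hM hMh q μ)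
  unfold radH
  linarith [hx.2 μ]

/-- **`H(□) ⊂ C_j(□)`**. [cite: Balaban1985BackgroundPropagators, p.408 (Ω_{j+1}(□) ⊂ Ω_j(□)), bookkeeping] -/
theorem InC_of_InH (hL : Odd (ℓ + 1)) (hM : Odd Mh) (hMh : 1 ≤ Mh) (hP : ∀ μ, 1 ≤ P μ)
    {q : ↥(cubes D.toDomains)} {x : Fin (d + 1) → ℤ} (hx : InH q x) : InC q q.1.1 x := by
  intro μ
  have h := circAbs_ctrC_le_of_InH hL hM hMh hP hx μ
  have e := radH_add_eq_wid hL hM R q.1.1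
  have hS := sI_pos (ℓ := ℓ) hMh q.1.1
  have : radH ℓ Mh q.1.1 ≤ wid ℓ Mh R q.1.1 q.1.1 := by nlinarith
  exact h.trans this

open Classical in
/-- `prof ≤ j + 1`. [cite: Balaban1985BackgroundPropagators, p.408 (levels n = 0, …, j+1), bookkeeping] -/
theorem prof_le (q : ↥(cubes D.toDomains)) (x : Fin (d + 1) → ℤ) : prof q x ≤ q.1.1 + 1 := by
  unfold prof; split_ifs
  · exact le_rfl
  · exact (Nat.findGreatest_le _).trans (Nat.le_succ _)

open Classical in
/-- **THE MEMBERSHIP DICTIONARY, levels `1 … j`**: `J ≤ prof(x) ⟺ x ∈ C_J(□)`. [cite: Balaban1985BackgroundPropagators, p.408 (Ω_J(□) = the level-J cube)] -/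
theorem le_prof_iff (hL : Odd (ℓ + 1)) (hM : Odd Mh) (hMh : 1 ≤ Mh) (hP : ∀ μ, 1 ≤ P μ) {q : ↥(cubes D.toDomains)}
    {J : ℕ} (hJ1 : 1 ≤ J) (hJj : J ≤ q.1.1) (x : Fin (d + 1) → ℤ) : J ≤ prof q x ↔ InC q J x := by
  unfold prof
  by_cases h : InH q x
  · rw [if_pos h]
    exact ⟨fun _ => InC_of_le hMh hJj (InC_of_InH hL hM hMh hP h), fun _ => hJj.trans (Nat.le_succ _)⟩
  · rw [if_neg h]
    constructor
    · intro hle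
      have hne : Nat.findGreatest (fun J => InC q J x) q.1.1 ≠ 0 := by omega
      exact InC_of_le hMh hle (Nat.findGreatest_of_ne_zero rfl hne)
    · intro hx
      exact Nat.le_findGreatest hJj hx

open Classical in
/-- **THE MEMBERSHIP DICTIONARY, level `j + 1`**: `j + 1 ≤ prof(x) ⟺ x ∈ H(□)`. [cite: Balaban1985BackgroundPropagators, p.408 (Ω_{j+1}(□))] -/
theorem succ_le_prof_iff (q : ↥(cubes D.toDomains)) (x : Fin (d + 1) → ℤ) : q.1.1 + 1 ≤ prof q x ↔ InH q x := by
  unfold prof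
  by_cases h : InH q x
  · rw [if_pos h]; exact ⟨fun _ => h, fun _ => le_rfl⟩
  · rw [if_neg h]
    refine ⟨fun hle => absurd ((Nat.findGreatest_le _).trans_lt (Nat.lt_of_succ_le hle)) (lt_irrefl _), fun h' => (h h').elim⟩

open Classical in
/-- `prof = 0` off `C₁(□)`: the exterior is print's level `0`. [cite: Balaban1985BackgroundPropagators, p.408 («Λ₀»); Balaban1984PropagatorsII, (2.3) p.224 («Λ₀ = Ω₁^c»)] -/
theorem prof_eq_zero (hL : Odd (ℓ + 1)) (hM : Odd Mh) (hMh : 1 ≤ Mh) (hP : ∀ μ, 1 ≤ P μ) {q : ↥(cubes D.toDomains)}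
    {x : Fin (d + 1) → ℤ} (hx : ¬ InC q 1 x) : prof q x = 0 := by
  by_contra h
  have h1 : 1 ≤ prof q x := Nat.one_le_iff_ne_zero.2 h
  exact hx ((le_prof_iff hL hM hMh hP le_rfl (one_le_cube_level q) x).1 h1)

/-- **(2.1) FOR THE CONCENTRIC CUBES**: membership of `C_J(□)` depends only on the big `J`-block (`1 ≤ J ≤ j`). [cite: Balaban1984PropagatorsII, (2.1) p.224; Balaban1985BackgroundPropagators, p.408 («This sequence satisfies the conditions (2.1), (2.2)»)] -/
theorem InC_iff_of_blk_eq (hL : Odd (ℓ + 1)) (hM : Odd Mh) (hMh : 1 ≤ Mh) (hP : ∀ μ, 1 ≤ P μ) {q : ↥(cubes D.toDomains)}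
    {J : ℕ} (hJj : J ≤ q.1.1) {x x' : Fin (d + 1) → ℤ} (hb : blk (bigSide ℓ Mh J) x' = blk (bigSide ℓ Mh J) x) :
    InC q J x ↔ InC q J x' := by
  have hSN := sI_dvd_N0 (ℓ := ℓ) (Mh := Mh) P (hJj.trans (cube_level_le q))
  have hS : 0 < sI ℓ Mh J := sI_pos hMh J
  have h1 := two_mul_hf_add_one hL hM q.1.1
  -- the window of level `J` has its ends on the `S_J`-grid
  have hlo : ∀ μ, sI ℓ Mh J ∣ ctrC q μ - wid ℓ Mh R q.1.1 J := fun μ => by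
    have e : ctrC q μ - wid ℓ Mh R q.1.1 J = q.1.2 μ * sI ℓ Mh q.1.1 - collar ℓ Mh R q.1.1 J := by unfold ctrC wid; ring
    rw [e]; exact dvd_sub (Dvd.dvd.mul_left (sI_dvd_sI hJj) _) (sI_dvd_collar R hJj)
  have hhi : ∀ μ, sI ℓ Mh J ∣ ctrC q μ + wid ℓ Mh R q.1.1 J + 1 := fun μ => by
    have e : ctrC q μ + wid ℓ Mh R q.1.1 J + 1 = (q.1.2 μ + 1) * sI ℓ Mh q.1.1 + collar ℓ Mh R q.1.1 J := by
      unfold ctrC wid; linear_combination h1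
    rw [e]; exact dvd_add (Dvd.dvd.mul_left (sI_dvd_sI hJj) _) (sI_dvd_collar R hJj)
  have hbμ : ∀ μ, x μ / sI ℓ Mh J = x' μ / sI ℓ Mh J := fun μ => by
    have := congrFun hb μ; unfold blk at this; unfold sI; exact this.symm
  constructor
  · intro h μ
    exact window_of_blk_eq (one_le_N0 hMh hP μ) hS (hSN μ) (hlo μ) (hhi μ) (hbμ μ) (h μ)
  · intro h μ
    exact window_of_blk_eq (one_le_N0 hMh hP μ) hS (hSN μ) (hlo μ) (hhi μ) (hbμ μ).symm (h μ)

/-- **(2.1) FOR THE HULL**: membership of `H(□)` depends only on the big `(j+1)`-block. [cite: Balaban1984PropagatorsII, (2.1) p.224; Balaban1985BackgroundPropagators, p.408] -/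
theorem InH_iff_of_blk_eq (hL : Odd (ℓ + 1)) (hM : Odd Mh) (hMh : 1 ≤ Mh) (hP : ∀ μ, 1 ≤ P μ) {q : ↥(cubes D.toDomains)}
    {x x' : Fin (d + 1) → ℤ} (hb : blk (bigSide ℓ Mh (q.1.1 + 1)) x' = blk (bigSide ℓ Mh (q.1.1 + 1)) x) :
    InH q x ↔ InH q x' := by
  by_cases hjk : q.1.1 + 1 ≤ k
  · have hSN := sI_dvd_N0 (ℓ := ℓ) (Mh := Mh) P hjk
    have hS : 0 < sI ℓ Mh (q.1.1 + 1) := sI_pos hMh _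
    have h1 := two_mul_hf_add_one hL hM q.1.1
    have h2 := two_mul_mL (ℓ := ℓ) hL
    have eS := sI_succ (ℓ := ℓ) (Mh := Mh) q.1.1
    have hlo : ∀ μ, sI ℓ Mh (q.1.1 + 1) ∣ ctrH q μ - widH ℓ Mh q.1.1 := fun μ => by
      refine ⟨q.1.2 μ / ((ℓ : ℤ) + 1) - 1, ?_⟩
      unfold ctrH widH; rw [eS]; linear_combination (-((ℓ : ℤ) + 1)) * h1 - h2
    have hhi : ∀ μ, sI ℓ Mh (q.1.1 + 1) ∣ ctrH q μ + widH ℓ Mh q.1.1 + 1 := fun μ => by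
      refine ⟨q.1.2 μ / ((ℓ : ℤ) + 1) + 2, ?_⟩
      unfold ctrH widH; rw [eS]; linear_combination (2 * ((ℓ : ℤ) + 1)) * h1 + 2 * h2
    have hbμ : ∀ μ, x μ / sI ℓ Mh (q.1.1 + 1) = x' μ / sI ℓ Mh (q.1.1 + 1) := fun μ => by
      have := congrFun hb μ; unfold blk at this; unfold sI; exact this.symm
    constructor
    · intro h; exact ⟨h.1, fun μ => window_of_blk_eq (one_le_N0 hMh hP μ) hS (hSN μ) (hlo μ) (hhi μ) (hbμ μ) (h.2 μ)⟩
    · intro h; exact ⟨h.1, fun μ => window_of_blk_eq (one_le_N0 hMh hP μ) hS (hSN μ) (hlo μ) (hhi μ) (hbμ μ).symm (h.2 μ)⟩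
  · exact ⟨fun h => (hjk h.1).elim, fun h => (hjk h.1).elim⟩

end Profile

/-! ## §4 The cube family `{Ω_n(□)}` as a level-0-admitting torus family on the member's torus -/

section Family

variable {ℓ Mh k R : ℕ} {P : Fin (d + 1) → ℕ}

/-- **THE CUBE FAMILY OF A COVER CUBE** (p. 408's `{Ω_n(□)}_{n=0,…,j+1}`, in the member's scale, exterior at level `0`): level
function `min (D.lev x) (prof q x)`; (2.1) and (2.2) (torus distance, the member's `R`) certified as the structure fields.
[cite: Balaban1985BackgroundPropagators, p.408 («This sequence satisfies the conditions (2.1), (2.2)»); Balaban1984PropagatorsII, (2.1)–(2.4) p.224, (2.14) p.225, p.229] -/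
noncomputable def cubeFam (D : B6MultiLevelTorusOperator.TDomains d ℓ Mh k P R) (q : ↥(cubes D.toDomains))
    (hL : Odd (ℓ + 1)) (hM : Odd Mh) (hMh : 1 ≤ Mh) (hP : ∀ μ, 1 ≤ P μ) :
    B6MultiLevelTorusOperatorL0.TDomains d ℓ Mh k P R where
  lev x := min (D.lev x) (prof q x)
  lev_le x := (min_le_left _ _).trans (D.lev_le x)
  bigBlocks J hJ x hx x' hx' hb := by
    rw [le_min_iff, le_min_iff]
    have hD : J ≤ D.lev x ↔ J ≤ D.lev x' := by
      rcases Nat.lt_or_ge J 2 with hJ2 | hJ2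
      · have hJ1 : J = 1 := by omega
        subst hJ1
        exact ⟨fun _ => D.one_le_lev x', fun _ => D.one_le_lev x⟩
      · exact D.bigBlocks J hJ2 x hx x' hx' hb
    have hPr : J ≤ prof q x ↔ J ≤ prof q x' := by
      rcases Nat.lt_trichotomy J (q.1.1 + 1) with hlt | heq | hgt
      · have hJj : J ≤ q.1.1 := Nat.lt_succ_iff.1 hlt
        rw [le_prof_iff hL hM hMh hP hJ hJj, le_prof_iff hL hM hMh hP hJ hJj]
        exact InC_iff_of_blk_eq hL hM hMh hP hJj hb
      · subst heq
        rw [succ_le_prof_iff, succ_le_prof_iff]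
        exact InH_iff_of_blk_eq hL hM hMh hP hb
      · constructor
        · intro h; exact absurd ((prof_le q x).trans_lt hgt) (not_lt.2 h)
        · intro h; exact absurd ((prof_le q x').trans_lt hgt) (not_lt.2 h)
    exact and_congr hD hPr
  sepT J x hx x' hx' h1 h2 := by
    have h2D : J + 1 ≤ D.lev x' := h2.trans (min_le_left _ _)
    have h2p : J + 1 ≤ prof q x' := h2.trans (min_le_right _ _)
    rcases lt_or_ge (D.lev x) J with hD | hD
    · exact D.sepT J x hx x' hx' hD h2D
    · -- the global level of `x` is `≥ J`, so its profile level is `< J`: the profile's collar separates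
      have hp : prof q x < J := by
        rcases min_lt_iff.1 h1 with h | h
        · exact absurd h (not_lt.2 hD)
        · exact h
      have hJ1 : 1 ≤ J := by omega
      have hJj : J ≤ q.1.1 := by have := prof_le q x'; omega
      have hnot : ¬ InC q J x := fun h => absurd ((le_prof_iff hL hM hMh hP hJ1 hJj x).2 h) (not_le.2 hp)
      have hnot' : ¬ ∀ μ, circAbs (N0 ℓ Mh k P μ) (x μ - ctrC q μ) ≤ wid ℓ Mh R q.1.1 J := hnot
      obtain ⟨μ, hμn⟩ := not_forall.1 hnot'
      have hμ : wid ℓ Mh R q.1.1 J < circAbs (N0 ℓ Mh k P μ) (x μ - ctrC q μ) := not_le.1 hμn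
      have hN : 1 ≤ N0 ℓ Mh k P μ := one_le_N0 hMh hP μ
      have hS : 0 < sI ℓ Mh J := sI_pos hMh J
      -- the upper window of `x′`: level `J + 1 ≤ j` (the next cube) or `J = j` (the hull)
      have hx'win : circAbs (N0 ℓ Mh k P μ) (x' μ - ctrC q μ) ≤ wid ℓ Mh R q.1.1 J - ((R : ℤ) + 1) * sI ℓ Mh J := by
        rcases Nat.lt_or_ge J q.1.1 with hlt | hge
        · have hC : InC q (J + 1) x' := (le_prof_iff hL hM hMh hP (by omega) hlt x').1 h2p
          have e := collar_succ (ℓ := ℓ) (Mh := Mh) (R := R) hlt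
          have : wid ℓ Mh R q.1.1 (J + 1) ≤ wid ℓ Mh R q.1.1 J - ((R : ℤ) + 1) * sI ℓ Mh J := by
            unfold wid; nlinarith
          exact (hC μ).trans this
        · have hJe : J = q.1.1 := le_antisymm hJj hge
          subst hJe
          have hH : InH q x' := (succ_le_prof_iff q x').1 h2p
          have h := circAbs_ctrC_le_of_InH hL hM hMh hP hH μ
          have e := radH_add_eq_wid hL hM R q.1.1
          linarith
      have hgap := gap_of_windows hN hμ hx'win
      -- `dist_T(x, x′) ≥ circAbs((x − x′)_μ) > (R + 1)·S_J > R·S_J`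
      have hc : (((R : ℤ) + 1) * sI ℓ Mh J : ℤ) < circAbs (N0 ℓ Mh k P μ) ((x - x') μ) := by
        rw [Pi.sub_apply]; linarith
      have hc' : ((((R : ℤ) + 1) * sI ℓ Mh J : ℤ) : ℝ) < torusSupNorm (N0 ℓ Mh k P) (x - x') :=
        lt_of_lt_of_le (by exact_mod_cast hc) (circAbs_le_torusSupNorm _ _ μ)
      refine lt_of_le_of_lt ?_ hc'
      unfold sI; push_cast; nlinarith [show (0 : ℝ) ≤ (bigSide ℓ Mh J : ℝ) by positivity]

variable {D : B6MultiLevelTorusOperator.TDomains d ℓ Mh k P R} {q : ↥(cubes D.toDomains)}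
  {hL : Odd (ℓ + 1)} {hM : Odd Mh} {hMh : 1 ≤ Mh} {hP : ∀ μ, 1 ≤ P μ}

/-- the level function of the cube family, unfolded. [cite: Balaban1985BackgroundPropagators, p.408, dictionary] -/
@[simp] theorem lev_cubeFam (x : Fin (d + 1) → ℤ) : (cubeFam D q hL hM hMh hP).lev x = min (D.lev x) (prof q x) := rfl

/-- the cube family's levels are at most the global ones (`Ω_n(□) ⊂ Ω_n`). [cite: Balaban1985BackgroundPropagators, p.408 («Ω_{j+1}(□) = □³ ∩ B^{j+1}(Λ_{j+1})»), bookkeeping] -/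
theorem lev_cubeFam_le (x : Fin (d + 1) → ℤ) : (cubeFam D q hL hM hMh hP).lev x ≤ D.lev x := min_le_left _ _

/-- the cube family's levels are at most `j + 1`. [cite: Balaban1985BackgroundPropagators, p.408 (n = 0, …, j+1), bookkeeping] -/
theorem lev_cubeFam_le_succ (x : Fin (d + 1) → ℤ) : (cubeFam D q hL hM hMh hP).lev x ≤ q.1.1 + 1 :=
  (min_le_right _ _).trans (prof_le q x)

/-- off `C₁(□)` the cube family is at level `0` (print's exterior «Λ₀»). [cite: Balaban1985BackgroundPropagators, p.408; Balaban1984PropagatorsII, (2.3) p.224] -/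
theorem lev_cubeFam_eq_zero {x : Fin (d + 1) → ℤ} (hx : ¬ InC q 1 x) : (cubeFam D q hL hM hMh hP).lev x = 0 := by
  rw [lev_cubeFam, prof_eq_zero hL hM hMh hP hx, Nat.min_zero]

/-- a site of the big block `β` is within `hf_j` of its centre in every coordinate. [cite: Balaban1985BackgroundPropagators, p.408, bookkeeping] -/
theorem abs_sub_ctrC_le_of_blk_eq (hL : Odd (ℓ + 1)) (hM : Odd Mh) (hMh : 1 ≤ Mh) (q : ↥(cubes D.toDomains))
    {x : Fin (d + 1) → ℤ} (hb : blk (bigSide ℓ Mh q.1.1) x = q.1.2) (μ : Fin (d + 1)) :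
    |x μ - ctrC q μ| ≤ hf ℓ Mh q.1.1 := by
  have hS : 0 < sI ℓ Mh q.1.1 := sI_pos hMh _
  have h1 := two_mul_hf_add_one hL hM q.1.1
  have hbμ : x μ / sI ℓ Mh q.1.1 = q.1.2 μ := by have := congrFun hb μ; unfold blk at this; unfold sI; exact this
  have e : x μ = q.1.2 μ * sI ℓ Mh q.1.1 + x μ % sI ℓ Mh q.1.1 := by
    have := Int.emod_def (x μ) (sI ℓ Mh q.1.1); rw [hbμ] at this; linear_combination (-1 : ℤ) * this
  have h0 := Int.emod_nonneg (x μ) hS.ne'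
  have h2 := Int.emod_lt_of_pos (x μ) hS
  unfold ctrC
  exact abs_le.2 ⟨by linarith, by linarith⟩

/-- **NO SITE OF GLOBAL LEVEL `≥ j + 2` LIES IN THE HULL** ((2.2) with `R ≥ 2`: such a site is more than `R·S_{j+1} ≥ 2L·S_j` from the
level-`j` witness of `β`, while the hull is within `2L·S_j − 1` of it). [cite: Balaban1984PropagatorsII, (2.2) p.224; Balaban1985BackgroundPropagators, p.408] -/
theorem lev_le_succ_of_InH (hL : Odd (ℓ + 1)) (hM : Odd Mh) (hMh : 1 ≤ Mh) (hP : ∀ μ, 1 ≤ P μ) (hR : 2 ≤ R)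
    {x : Fin (d + 1) → ℤ} (hx : x ∈ boxDom (N0 ℓ Mh k P)) (hH : InH (D := D) q x) :
    D.lev x ≤ q.1.1 + 1 := by
  by_contra hlt
  have hge : q.1.1 + 1 + 1 ≤ D.lev x := by omega
  set x₀ := wit D.toDomains q with hx₀
  have hl₀ : D.lev x₀.1 = q.1.1 := lev_wit D.toDomains q
  have hsep := D.sepT (q.1.1 + 1) x₀.1 x₀.2 x hx (by omega) hge
  -- upper bound on the torus distance from the witness to `x`
  have hup : torusSupNorm (N0 ℓ Mh k P) (x₀.1 - x) ≤ ((hf ℓ Mh q.1.1 + radH ℓ Mh q.1.1 : ℤ) : ℝ) := by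
    refine torusSupNorm_le_of_forall _ _ (fun μ => ?_)
    have hN : 1 ≤ N0 ℓ Mh k P μ := one_le_N0 hMh hP μ
    have t := circAbs_add_le hN (x₀.1 μ - ctrC q μ) (ctrC q μ - x μ)
    rw [show x₀.1 μ - ctrC q μ + (ctrC q μ - x μ) = (x₀.1 - x) μ by rw [Pi.sub_apply]; ring] at t
    have a1 : circAbs (N0 ℓ Mh k P μ) (x₀.1 μ - ctrC q μ) ≤ hf ℓ Mh q.1.1 :=
      (circAbs_le_abs hN _).trans (abs_sub_ctrC_le_of_blk_eq hL hM hMh q (blk_wit D.toDomains q) μ)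
    have a2 : circAbs (N0 ℓ Mh k P μ) (ctrC q μ - x μ) ≤ radH ℓ Mh q.1.1 := by
      rw [circAbs_sub_comm hN]; exact circAbs_ctrC_le_of_InH hL hM hMh hP hH μ
    exact_mod_cast t.trans (add_le_add a1 a2)
  have e := hf_add_radH hL hM (Mh := Mh) q.1.1
  have eS := sI_succ (ℓ := ℓ) (Mh := Mh) q.1.1
  have hS : 0 < sI ℓ Mh q.1.1 := sI_pos hMh _
  have hlow : (((R * bigSide ℓ Mh (q.1.1 + 1) : ℕ) : ℝ)) = (((R : ℤ) * sI ℓ Mh (q.1.1 + 1) : ℤ) : ℝ) := by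
    unfold sI; push_cast; ring
  rw [hlow] at hsep
  have hlt' : ((R : ℤ) * sI ℓ Mh (q.1.1 + 1) : ℤ) < hf ℓ Mh q.1.1 + radH ℓ Mh q.1.1 := by
    exact_mod_cast lt_of_lt_of_le hsep hup
  rw [e, eS] at hlt'
  have hR' : (2 : ℤ) ≤ (R : ℤ) := by exact_mod_cast hR
  have hL1 : (1 : ℤ) ≤ (ℓ : ℤ) + 1 := by linarith [Int.natCast_nonneg ℓ]
  have hprod : 0 ≤ ((R : ℤ) - 2) * (((ℓ : ℤ) + 1) * sI ℓ Mh q.1.1) :=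
    mul_nonneg (by linarith) (mul_nonneg (by linarith) hS.le)
  nlinarith

/-- **ON THE HULL THE CUBE FAMILY HAS THE GLOBAL LEVELS** — the rows of `Δ′_{a,□}` and `Δ′_a` agree on `H(□) ⊇ □³ ⊇ supp h_□`:
the identity behind (3.88). [cite: Balaban1985BackgroundPropagators, (3.88) p.409, p.408 (Ω_{j+1}(□) = □³ ∩ B^{j+1}(Λ_{j+1}))] -/
theorem lev_cubeFam_eq_of_InH (hR : 2 ≤ R) {x : Fin (d + 1) → ℤ} (hx : x ∈ boxDom (N0 ℓ Mh k P))
    (hH : InH (D := D) q x) : (cubeFam D q hL hM hMh hP).lev x = D.lev x := by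
  rw [lev_cubeFam]
  refine min_eq_left ?_
  have h1 : q.1.1 + 1 ≤ prof q x := (succ_le_prof_iff q x).2 hH
  exact (lev_le_succ_of_InH hL hM hMh hP hR hx hH).trans h1

/-- **THE CUBE FAMILY AS AN INDEX OF p33's CENSUS OF ALL LEVEL-0 TORUS FAMILIES** — so `prop22_supEntries_kLevelTorus` (the four
(3.42) sup entries of `G′ = gmlT` at `U = 1`, constants depending on `d, L` only) applies to `G′_□` BY NAME.
[cite: Balaban1985BackgroundPropagators, p.409 («The operators constructed for this sequence … satisfy all the inequalities of Theorems 3.1–3.3»); Balaban1984PropagatorsII, Prop. 2.2 (2.67) p.234] -/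
noncomputable def toKTIdx (D : B6MultiLevelTorusOperator.TDomains d ℓ Mh k P R) (q : ↥(cubes D.toDomains))
    (hL : Odd (ℓ + 1)) (hM : Odd Mh) (hk : 1 ≤ k) (hMh : 1 ≤ Mh) (hR : 2 * (ℓ + 1) ≤ R) (hP4 : ∀ μ, 4 ≤ P μ) :
    KTIdx d ℓ :=
  ⟨k, Mh, R, P, cubeFam D q hL hM hMh (fun μ => le_trans (by norm_num) (hP4 μ)), hk, hMh, hR, hP4⟩

/-- the census index carries the cube family. [cite: Balaban1985BackgroundPropagators, p.409, dictionary] -/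
theorem toKTIdx_D (D : B6MultiLevelTorusOperator.TDomains d ℓ Mh k P R) (q : ↥(cubes D.toDomains))
    (hL : Odd (ℓ + 1)) (hM : Odd Mh) (hk : 1 ≤ k) (hMh : 1 ≤ Mh) (hR : 2 * (ℓ + 1) ≤ R) (hP4 : ∀ μ, 4 ≤ P μ) :
    (toKTIdx D q hL hM hk hMh hR hP4).D = cubeFam D q hL hM hMh (fun μ => le_trans (by norm_num) (hP4 μ)) := rfl

/-- the census hypothesis `Hyp21_22` holds (it is built into the structure). [cite: Balaban1984PropagatorsII, (2.1)–(2.2) p.224, dictionary] -/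
theorem toKTIdx_hyp (D : B6MultiLevelTorusOperator.TDomains d ℓ Mh k P R) (q : ↥(cubes D.toDomains))
    (hL : Odd (ℓ + 1)) (hM : Odd Mh) (hk : 1 ≤ k) (hMh : 1 ≤ Mh) (hR : 2 * (ℓ + 1) ≤ R) (hP4 : ∀ μ, 4 ≤ P μ) :
    (toKTIdx D q hL hM hk hMh hR hP4).geoT.Hyp21_22 := trivial


/-! ## §5 (v1.1) Row agreement on the hull in EVERY case of the cover (top-level and rim cubes included) -/

/-- **`x` NEAR □**: every coordinate of `x` is within `(3LS_j − 1)/2` of the centre of the parent block of `β` — the geometric half of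
`InH` (no condition on `k`): the `3^{d+1}` big `(j+1)`-blocks around `β` (⊇ □³). [cite: Balaban1985BackgroundPropagators, p.408 (□³, □⁴)] -/
def NearH (q : ↥(cubes D.toDomains)) (x : Fin (d + 1) → ℤ) : Prop :=
  ∀ μ, circAbs (N0 ℓ Mh k P μ) (x μ - ctrH q μ) ≤ widH ℓ Mh q.1.1

/-- near □ every site lies in `C_j(□)` (the geometric content of `InC_of_InH`). [cite: Balaban1985BackgroundPropagators, p.408 (□³ ⊂ Ω_j(□)), bookkeeping] -/
theorem InC_of_nearH (hL : Odd (ℓ + 1)) (hM : Odd Mh) (hMh : 1 ≤ Mh) (hP : ∀ μ, 1 ≤ P μ) {x : Fin (d + 1) → ℤ}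
    (hx : NearH (D := D) q x) : InC q q.1.1 x := by
  intro μ
  have hN : 1 ≤ N0 ℓ Mh k P μ := one_le_N0 hMh hP μ
  have h1 := circAbs_add_le hN (x μ - ctrH q μ) (ctrH q μ - ctrC q μ)
  rw [show x μ - ctrH q μ + (ctrH q μ - ctrC q μ) = x μ - ctrC q μ by ring] at h1
  have h2 : circAbs (N0 ℓ Mh k P μ) (ctrH q μ - ctrC q μ) ≤ mL ℓ * sI ℓ Mh q.1.1 :=
    (circAbs_le_abs hN _).trans (by rw [abs_sub_comm]; exact abs_ctrC_sub_ctrH_le hL hM hMh q μ)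
  have e := radH_add_eq_wid hL hM R q.1.1
  have hS := sI_pos (ℓ := ℓ) hMh q.1.1
  unfold radH at e
  nlinarith [hx μ]

/-- **ON THE HULL THE CUBE FAMILY HAS THE GLOBAL LEVELS — EVERY CASE** (`R ≥ 2`): for a site near □ (`NearH`), `min (D.lev) (prof) =
D.lev`.  If `j + 1 ≤ k` this is `lev_cubeFam_eq_of_InH`; if `j = k` (top-level cube) the global level is `≤ k = j ≤ prof` on `C_j(□)`.
The lineage's RIM cubes (□³ meeting `B^{j−1}(Λ_{j−1})` — the case p. 408's dichotomy «□³ is either contained in B^j(Λ_j), or intersects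
also B^{j+1}(Λ_{j+1})» does not spell out; cf. the two-level window of [4] p. 235, `B6Cover236MultiLevelBlocks.js/hcube`,
`B6Partition118KLevelTorusWindow.two_level_ball`) are covered too: there the global levels near □ are `j − 1, j` and `min` keeps them —
the family realises the window reading «build {Ω_n(□)} at the base scale j₀ ∈ {j − 1, j}» with collars sized at scale `j`.  So the rows
of `Δ′_{a,□}` and `Δ′_a` agree on `supp h_□` for EVERY cover cube: the `hloc` identity of (3.88).
[cite: Balaban1985BackgroundPropagators, (3.88) p.409, p.408; Balaban1984PropagatorsII, (2.2) p.224, p.235] -/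
theorem lev_cubeFam_eq_of_nearH (hR : 2 ≤ R) {x : Fin (d + 1) → ℤ} (hx : x ∈ boxDom (N0 ℓ Mh k P))
    (hH : NearH (D := D) q x) : (cubeFam D q hL hM hMh hP).lev x = D.lev x := by
  by_cases hjk : q.1.1 + 1 ≤ k
  · exact lev_cubeFam_eq_of_InH hR hx ⟨hjk, hH⟩
  · rw [lev_cubeFam]
    refine min_eq_left ?_
    have hle : D.lev x ≤ q.1.1 := by have := D.lev_le x; have := cube_level_le q; omega
    exact hle.trans ((le_prof_iff hL hM hMh hP (one_le_cube_level q) le_rfl x).2 (InC_of_nearH hL hM hMh hP hH))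

end Family

end Literature.MathematicalPhysics.QuantumFieldTheory.Balaban1983to89.B9CubeSequence408
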